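import Summits.CriticalPhenomena.PercolationContinuityZ3.Theorems.PercNearOneGluingNoHeavyLowerTailSahiOneStepUniformMonoB
import HarnessLib

/-!
# One-step scheme: MONO-B survives one non-dominating coordinate

Prover prim-ineq-prove-3 gen 28 (`--supports stmt-CriticalPhenomena-4575`; memo
`run/shared/lean/prim/prim-ineq-prove-3/FINDING-G28-GOOD-PIVOT-REFUTED.md` §6–§7).  No definitions, no sorries.

Gen 21's proof of `(2′)` at uniform density (`…SahiOneStepUniformThreshold`) reduces every pair to an opposite-shifted, `H`-generated pair and
pivots at the dominant coordinate `e`; the `B`-side sign `U_B ≤ 0` (`drift_nonpos_of_dominated`, file `…UniformMonoB`) uses that `e` is dominated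
by EVERY other coordinate of the block.  For a density vector that is constant only on `F ∖ {o}` no measure-preserving compression between `e` and `o`
exists, so `e` is dominated by every coordinate except `o`.  This file shows that the `B`-side survives: the sections of `B` at `e` still agree on the
ball `{N_F < t}` (one level lower than in the fully dominated case, `section_sdiff_mem_of_dominated_erase`), and that ball is all the drift sees
(`drift_nonpos_of_dominated_erase`).  (The `A`-side `drift_nonneg_of_dominant` does NOT survive an odd coordinate in general; memo §6 records the
counterexamples and the two single-event statements — L6H‴ and the near-AND-literal pivot lemma — that would complete a one-odd-coordinate theorem.)
-/

noncomputable section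

namespace Summit.CriticalPhenomena.PercolationContinuityZ3.Theorems

namespace SahiOneStep

open MeasureTheory
open Literature.Probability.Percolation (DeterminedBy determinedBy_iff)
open Literature.Probability.LatticeModels (prodBernoulli)
open Literature.Probability.Percolation.DecisionTree (ind)
open SahiE3Sections (determinedBy_section_insert determinedBy_section_sdiff)
open scoped Classical

variable {ι : Type*} [Fintype ι]

/-! ## The combinatorial core with one exempt coordinate -/

omit [Fintype ι] in
/-- **MONO-B core with ONE non-dominating coordinate** (prim-ineq-prove-3 gen 28, memo FINDING-G28 §6 L7H).  As `section_sdiff_mem_of_dominated`,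
but the pivot `e` need only be dominated by the coordinates `j ∈ F` with `j ≠ o` (one coordinate `o` — e.g. a coordinate of a different density,
for which no measure-preserving compression with `e` exists — is exempt); in exchange the conclusion is asked only on the smaller ball
`#(F ∩ ω) < t`: the witness `z ⊇ ω ∖ {e}` in `H ∖ B` can exceed `ω` inside `F` only at `o`, so `#(F ∩ z) ≤ #(F ∩ ω) + 1 ≤ t < t+1`. [this work] -/
theorem section_sdiff_mem_of_dominated_erase {F : Finset ι} {e : ι} (heF : e ∉ F) (o : ι) {t : ℕ} {B : Set (Set ι)} (hB : IsUpperSet B)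
    (hdom : ∀ ω ∈ B, e ∈ ω → ∀ j ∈ F, j ≠ o → j ∉ ω → (ω \ {e}) ∪ {j} ∈ B)
    (hgen : ∀ ω : Set ι, (∀ ω' : Set ι, ω ⊆ ω' → t + 1 ≤ ((insert e F).filter (· ∈ ω')).card → ω' ∈ B) → ω ∈ B)
    {ω : Set ι} (hω : insert e ω ∈ B) (hsmall : (F.filter (· ∈ ω)).card < t) :
    ω \ {e} ∈ B := by
  by_contra hnot
  have hex : ∃ z : Set ι, ω \ {e} ⊆ z ∧ t + 1 ≤ ((insert e F).filter (· ∈ z)).card ∧ z ∉ B := by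
    by_contra h
    push Not at h
    exact hnot (hgen _ fun ω' h1 h2 => h ω' h1 h2)
  obtain ⟨z, hsub, hzH, hzB⟩ := hex
  -- `e ∉ z`, for otherwise `insert e ω ⊆ z ∈ B`
  have hez : e ∉ z := by
    intro hez
    refine hzB (hB ?_ hω)
    intro x hx
    rcases hx with rfl | hx
    · exact hez
    · by_cases hxe : x = e
      · exact hxe ▸ hez
      · exact hsub ⟨hx, hxe⟩
  -- `F ∩ z ⊆ ω ∪ {o}`
  have hFz : ∀ j ∈ F, j ≠ o → j ∈ z → j ∈ ω := by
    intro j hjF hjo hjz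
    by_contra hjω
    have hje : j ≠ e := fun h => heF (h ▸ hjF)
    -- trade `j` for `e`
    have hz'B : (z \ {j}) ∪ {e} ∉ B := by
      intro hz'B
      have hjz' : j ∉ (z \ {j}) ∪ {e} := by
        rintro (⟨_, hj⟩ | hj)
        · exact hj rfl
        · exact hje hj
      have h := hdom _ hz'B (Or.inr rfl) j hjF hjo hjz'
      have heq : ((z \ {j}) ∪ {e}) \ {e} ∪ {j} = z := by
        ext x
        simp only [Set.mem_union, Set.mem_sdiff, Set.mem_singleton_iff]
        constructor
        · rintro (⟨⟨hx, _⟩ | hx, hxe⟩ | rfl)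
          · exact hx
          · exact absurd hx hxe
          · exact hjz
        · intro hx
          by_cases hxj : x = j
          · exact Or.inr hxj
          · exact Or.inl ⟨Or.inl ⟨hx, hxj⟩, fun hxe => hez (hxe ▸ hx)⟩
      rw [heq] at h
      exact hzB h
    have hz'H : t + 1 ≤ ((insert e F).filter (· ∈ (z \ {j}) ∪ {e})).card := by
      have hfe : (insert e F).filter (· ∈ (z \ {j}) ∪ {e}) = insert e (((insert e F).filter (· ∈ z)).erase j) := by
        ext i
        simp only [Finset.mem_filter, Finset.mem_insert, Finset.mem_erase, Set.mem_union, Set.mem_sdiff,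
          Set.mem_singleton_iff]
        constructor
        · rintro ⟨hi, ⟨hiz, hij⟩ | hie⟩
          · exact Or.inr ⟨hij, hi, hiz⟩
          · exact Or.inl hie
        · rintro (hie | ⟨hij, hi, hiz⟩)
          · exact ⟨Or.inl hie, Or.inr hie⟩
          · exact ⟨hi, Or.inl ⟨hiz, hij⟩⟩
      have hjmem : j ∈ (insert e F).filter (· ∈ z) := Finset.mem_filter.2 ⟨Finset.mem_insert_of_mem hjF, hjz⟩
      have hemem : e ∉ ((insert e F).filter (· ∈ z)).erase j := fun h => hez (Finset.mem_filter.1 (Finset.mem_of_mem_erase h)).2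
      rw [hfe, Finset.card_insert_of_notMem hemem, Finset.card_erase_of_mem hjmem]
      have hpos : 0 < ((insert e F).filter (· ∈ z)).card := Finset.card_pos.2 ⟨j, hjmem⟩
      omega
    have hsub' : insert e ω ⊆ (z \ {j}) ∪ {e} := by
      intro x hx
      rcases hx with rfl | hx
      · exact Or.inr rfl
      · by_cases hxe : x = e
        · exact Or.inr hxe
        · exact Or.inl ⟨hsub ⟨hx, hxe⟩, fun hxj => hjω (hxj ▸ hx)⟩
    exact hz'B (hB hsub' hω)
  -- count: `t+1 ≤ #(insert e F ∩ z) = #(F ∩ z) ≤ #(F ∩ ω) + 1 ≤ t`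
  have h1 : ((insert e F).filter (· ∈ z)).card = (F.filter (· ∈ z)).card := by
    rw [Finset.filter_insert, if_neg hez]
  have h2 : (F.filter (· ∈ z)).card ≤ (F.filter (· ∈ ω)).card + 1 :=
    calc (F.filter (· ∈ z)).card ≤ (insert o (F.filter (· ∈ ω))).card :=
          Finset.card_le_card fun j hj => by
            rw [Finset.mem_filter] at hj
            rw [Finset.mem_insert, Finset.mem_filter]
            by_cases hjo : j = o
            · exact Or.inl hjo
            · exact Or.inr ⟨hj.1, hFz j hj.1 hjo hj.2⟩
      _ ≤ (F.filter (· ∈ ω)).card + 1 := Finset.card_insert_le _ _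
  omega

omit [Fintype ι] in
/-- Consequently the two sections of `B` at `e` agree on the ball `{N_F < s}` for every `s ≤ t` (one level less than in the fully dominated case). [this work] -/
theorem section_inter_ball_eq_of_dominated_erase {F : Finset ι} {e : ι} (heF : e ∉ F) (o : ι) {t : ℕ} {B : Set (Set ι)} (hB : IsUpperSet B)
    (hdom : ∀ ω ∈ B, e ∈ ω → ∀ j ∈ F, j ≠ o → j ∉ ω → (ω \ {e}) ∪ {j} ∈ B)
    (hgen : ∀ ω : Set ι, (∀ ω' : Set ι, ω ⊆ ω' → t + 1 ≤ ((insert e F).filter (· ∈ ω')).card → ω' ∈ B) → ω ∈ B)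
    {s : ℕ} (hs : s ≤ t) :
    {ω : Set ι | insert e ω ∈ B} ∩ {ω : Set ι | (F.filter (· ∈ ω)).card < s} =
      {ω : Set ι | ω \ {e} ∈ B} ∩ {ω : Set ι | (F.filter (· ∈ ω)).card < s} := by
  ext ω
  simp only [Set.mem_inter_iff, Set.mem_setOf_eq]
  constructor
  · rintro ⟨h1, h2⟩
    exact ⟨section_sdiff_mem_of_dominated_erase heF o hB hdom hgen h1 (by omega), h2⟩
  · rintro ⟨h0, h2⟩
    exact ⟨section_sdiff_subset_section_insert hB e h0, h2⟩

/-! ## The drift -/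

/-- **MONO-B WITH ONE NON-DOMINATING COORDINATE** (prim-ineq-prove-3 gen 28, memo FINDING-G28 §6 L7H): for the threshold slot
`H = {t+1 ≤ #(insert e F ∩ ω)}` (`e ∉ F`) and an increasing, `insert e F`-determined, `H`-generated event `B` in which the pivot `e` is dominated by
every coordinate of `F` except possibly one coordinate `o`, the ball-conditioned drift `U_B` of the cross-form step lemma is still `≤ 0` — the
drift only sees the sections on the ball `{N_F < t}`, where they agree by `section_inter_ball_eq_of_dominated_erase`.  This is the `B`-side of the
pivot step for density vectors that are constant on `F ∖ {o}` (compressions are available only between coordinates of equal density). [this work] -/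
theorem drift_nonpos_of_dominated_erase (p : ι → unitInterval) {F : Finset ι} {e : ι} (heF : e ∉ F) (o : ι) (t : ℕ) {B : Set (Set ι)}
    (hB : IsUpperSet B) (hBF : DeterminedBy B (↑(insert e F) : Set ι))
    (hdom : ∀ ω ∈ B, e ∈ ω → ∀ j ∈ F, j ≠ o → j ∉ ω → (ω \ {e}) ∪ {j} ∈ B)
    (hgen : ∀ ω : Set ι, (∀ ω' : Set ι, ω ⊆ ω' → t + 1 ≤ ((insert e F).filter (· ∈ ω')).card → ω' ∈ B) → ω ∈ B) :
    (1 - (prodBernoulli p).real {ω : Set ι | ω \ {e} ∈ {ω : Set ι | t + 1 ≤ ((insert e F).filter (· ∈ ω)).card}}) *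
          ((prodBernoulli p).real {ω : Set ι | insert e ω ∈ B} -
            (prodBernoulli p).real ({ω : Set ι | insert e ω ∈ {ω : Set ι | t + 1 ≤ ((insert e F).filter (· ∈ ω)).card}} ∩
              {ω : Set ι | insert e ω ∈ B}))
        - (1 - (prodBernoulli p).real {ω : Set ι | insert e ω ∈ {ω : Set ι | t + 1 ≤ ((insert e F).filter (· ∈ ω)).card}}) *
          ((prodBernoulli p).real {ω : Set ι | ω \ {e} ∈ B} -
            (prodBernoulli p).real ({ω : Set ι | ω \ {e} ∈ {ω : Set ι | t + 1 ≤ ((insert e F).filter (· ∈ ω)).card}} ∩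
              {ω : Set ι | ω \ {e} ∈ B})) ≤ 0 := by
  rw [section_insert_threshold heF, section_sdiff_threshold heF, one_sub_real_threshold, one_sub_real_threshold,
    real_sub_real_threshold_inter, real_sub_real_threshold_inter]
  -- the sections agree below level `t` (and below `t+1`)
  have hcoe : (↑(insert e F) : Set ι) \ {e} = ↑F := by
    ext i
    simp only [Set.mem_sdiff, Finset.coe_insert, Set.mem_insert_iff, Finset.mem_coe, Set.mem_singleton_iff]
    constructor
    · rintro ⟨h | h, hne⟩
      · exact absurd h hne
      · exact h
    · intro h
      exact ⟨Or.inr h, fun hie => heF (hie ▸ h)⟩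
  have hB0F : DeterminedBy {ω : Set ι | ω \ {e} ∈ B} (↑F : Set ι) := hcoe ▸ determinedBy_section_sdiff hBF e
  have hB0 : IsUpperSet {ω : Set ι | ω \ {e} ∈ B} := isUpperSet_section_sdiff hB e
  rw [section_inter_ball_eq_of_dominated_erase heF o hB hdom hgen (le_refl t)]
  have h := real_inter_ball_mul_le p F hB0 hB0F t
  linarith


end SahiOneStep

end Summit.CriticalPhenomena.PercolationContinuityZ3.Theorems
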